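import Summits.HodgeConjecture.HodgeConjecture.Theorems.Ring2WeilCoverageWeilGramCMPoint
import Summits.HodgeConjecture.HodgeConjecture.Theorems.Ring2WeilCoverageCyclotomicUnconditional
import Summits.HodgeConjecture.HodgeConjecture.Theorems.Ring2WeilCoverageRealUnitNormHalfSystems
import Summits.HodgeConjecture.HodgeConjecture.Theorems.Ring2WeilCoverageNormTable
import HarnessLib

/-!
# Weil-type family coverage — THE COMPONENTS OF THE WEIL-TYPE `ℤ[ζ₄₄]`-TENFOLDS, I: level lemmas (`Φ₄₄(ζ) = 0` written
# out, the real frame `θ^i`, the skew generators `s₁₁ = 1 + 2(ζ⁴ + ζ¹² + ζ¹⁶ + ζ²⁰ + ζ³⁶) = √−11` (Gauss sum of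
# `ζ₁₁ = ζ⁴`) and `i = ζ¹¹`, the census parameter `ξ = ζ⁹/Φ₄₄′(ζ)`, `θ¹⁰` and the trace recurrence)

research route conditional on HC_CM; not a corollary; Q11.4-sentence-2 already refuted in dim ≥ 3.

Ring 2, WEIL-TYPE FAMILY-COVERAGE CENSUS (`HOME/WEIL-FAMILY-COVERAGE.md` `## b01`, block b01.41 (C) «COMPONENTS (S-pencil,
exact)» at `g = 10` and b01.48 «NEXT: the `g = 10/12` placements»; owner ring2-b01), part 127 of the `Ring2WeilCoverage*`
series: the level-`44` twin of part 120 (`K = ℚ(ζ₄₄)`, `g = 10`, `n = 5`, real frame `xᵢ = θ^i`, `θ = ζ + ζ⁻¹`, `i < 10`).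
For a skew `ζ′` and a skew `s` with `s² = −d`
part 82 (`Ring2WeilCoverageWeilGramCMPoint`) shows that the Gram matrix `Ψ = a + b√−d` of van Geemen's hermitian form
`H = E(x, sy) + √−d E(x, y)`, `E = E_ζ′ = Tr_{K/ℚ}(ζ′xȳ)`, in a real frame is the rational matrix `a = (−Tr(ζ′s xᵢxⱼ))`,
`b = 0`, with `det a = (−2)^g N_{K⁺/ℚ}(ζ′s) disc(ω)`; for `n = 5` the split class is `[−1]·Nm` and a `Φ`-positive `ζ′` on
a Weil-type (`(5,5)`) CM type has `(−1)⁵ det a > 0`, i.e. `det a < 0` (part 92).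

This file holds only the level lemmas shared by the tenfold Gram files `Ring2WeilCoverageWeilGramLevel44*` (parts 128+):
`Φ₄₄(ζ) = 0` written out, `θ` and the frame `θ^i` are real, `ξ` is skew, `s₁₁² = −11`, `(ζ¹¹)² = −1`, both skew, `θ¹⁰`
in the frame (the minimal polynomial of `θ`) and the trace recurrences `Tr(yθ^m)`, `10 ≤ m ≤ 18`.

HONEST FRAMING as parts 82–126: kernel statements about elements of `ℚ(ζ₄₄)`; nothing about Hodge classes, `W_K`,
general members or HC; `HC_CM` is used nowhere.  No `def`, no named fact, no `sorry`.  Certificates produced by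
`work/py/geng.py` + `lev44.py` (exact arithmetic in `ℚ[x]/Φ₄₄`, stdlib) and re-verified here by `linear_combination`.

References: [cite: vanGeemen1994HodgeAV, Lemma 5.2 (2)–(4)]; [cite: Shimura1998, §14.3 Prop. 4–5, pp. 103–104]; [folklore].
-/

noncomputable section

open Polynomial NumberField Module
open scoped nonZeroDivisors

namespace Summit.HodgeConjecture.Ring2WeilCoverage.WeilGramLevel44

open Literature.NumberTheory.ComplexMultiplication
open Summit.HodgeConjecture.Ring2WeilCoverage.RealUnitNormHalfSystems (complexConj_eq_inv)
open Summit.HodgeConjecture.Ring2WeilCoverage.CyclotomicPrincipalObstruction (complexConj_xi)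
variable {K : Type} [Field K] [NumberField K] {ζ : K}

/-! ### §0 Level lemmas -/

omit [NumberField K] in
/-- **`Φ₄₄(ζ) = 0` written out** (`(x²² − 1)(x² + 1)Φ₄₄(x) = x⁴⁴ − 1`, `ζ²² ≠ 1`, `ζ⁴ ≠ 1`). research route conditional on HC_CM; not a corollary; Q11.4-sentence-2 already refuted in dim ≥ 3. [folklore] -/
theorem cyc_fortyFour (hζ : IsPrimitiveRoot ζ 44) :
    ζ ^ 20 - ζ ^ 18 + ζ ^ 16 - ζ ^ 14 + ζ ^ 12 - ζ ^ 10 + ζ ^ 8 - ζ ^ 6 + ζ ^ 4 - ζ ^ 2 + 1 = 0 := by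
  have h44 : ζ ^ 44 = 1 := hζ.pow_eq_one
  have h22 : ζ ^ 22 - 1 ≠ 0 := sub_ne_zero.mpr (hζ.pow_ne_one_of_pos_of_lt (by norm_num) (by norm_num))
  have h4 : ζ ^ 4 ≠ 1 := hζ.pow_ne_one_of_pos_of_lt (by norm_num) (by norm_num)
  have h2 : ζ ^ 2 + 1 ≠ 0 := by
    intro h
    apply h4
    linear_combination (ζ ^ 2 - 1) * h
  have h : (ζ ^ 22 - 1) * (ζ ^ 2 + 1) *
      (ζ ^ 20 - ζ ^ 18 + ζ ^ 16 - ζ ^ 14 + ζ ^ 12 - ζ ^ 10 + ζ ^ 8 - ζ ^ 6 + ζ ^ 4 - ζ ^ 2 + 1) = 0 := by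
    linear_combination h44
  rcases mul_eq_zero.mp h with h' | h'
  · exact absurd h' (mul_ne_zero h22 h2)
  · exact h'

omit [NumberField K] in
/-- `(ζ⁻¹)^a = ζ^b` when `a + b = 44`. [folklore] -/
theorem inv_pow_eq_pow (hζ : IsPrimitiveRoot ζ 44) {a b : ℕ} (hab : a + b = 44) : ζ⁻¹ ^ a = ζ ^ b := by
  rw [inv_pow]
  apply inv_eq_of_mul_eq_one_right
  rw [← pow_add, hab, hζ.pow_eq_one]

/-- `θ = ζ + ζ⁻¹` is real. [folklore] -/
theorem complexConj_theta [IsCMField K] (hζ : IsPrimitiveRoot ζ 44) :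
    IsCMField.complexConj K (ζ + ζ⁻¹) = ζ + ζ⁻¹ := by
  rw [map_add, map_inv₀, complexConj_eq_inv hζ, inv_inv, add_comm]

/-- The frame `xᵢ = θ^i` is real. [folklore] -/
theorem complexConj_thetaFrame [IsCMField K] (hζ : IsPrimitiveRoot ζ 44) {m : ℕ} {x : Fin m → K}
    (hx : ∀ i, x i = (ζ + ζ⁻¹) ^ (i : ℕ)) (i : Fin m) : IsCMField.complexConj K (x i) = x i := by
  rw [hx i, map_pow, complexConj_theta hζ]

/-- `ξ = ζ^9/Φ′(ζ)` is skew (part 7, `g − 1 = 9`). [folklore] -/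
theorem complexConj_xi_fortyFour [IsCMField K] (hζ : IsPrimitiveRoot ζ 44) :
    IsCMField.complexConj K (ζ ^ 9 * (aeval ζ (derivative (cyclotomic 44 ℚ)))⁻¹) =
      -(ζ ^ 9 * (aeval ζ (derivative (cyclotomic 44 ℚ)))⁻¹) :=
  complexConj_xi hζ (k := 9) (by decide)

/-! ### §1 The skew generators `s₁₁ = √−11` and `i = ζ¹¹` -/

omit [NumberField K] in
/-- **`(1 + 2(ζ⁴ + ζ¹² + ζ¹⁶ + ζ²⁰ + ζ³⁶))² = −11`**: `s = √−11 = 1 + 2(ζ⁴ + ζ¹² + ζ¹⁶ + ζ²⁰ + ζ³⁶)` generates `K_d = ℚ(√−11) ⊂ ℚ(ζ_44)`. [folklore] -/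
theorem sq_sqrtNegEleven (hζ : IsPrimitiveRoot ζ 44) : (1 + 2 * (ζ ^ 4 + ζ ^ 12 + ζ ^ 16 + ζ ^ 20 + ζ ^ 36)) ^ 2 = -11 := by
  have h44 : ζ ^ 44 = 1 := hζ.pow_eq_one
  linear_combination (12 + 12 * ζ^2 + 12 * ζ^4 + 12 * ζ^6 + 12 * ζ^8 + 12 * ζ^10 + 12 * ζ^12 + 12 * ζ^14 + 12 * ζ^16 + 12 * ζ^18 + 12 * ζ^20) * cyc_fortyFour hζ +
    (8 * ζ^4 + 8 * ζ^8 + 8 * ζ^12 + 4 * ζ^28) * h44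

/-- **`s = √−11 = 1 + 2(ζ⁴ + ζ¹² + ζ¹⁶ + ζ²⁰ + ζ³⁶)` is skew** (`s^ρ = −s`). [folklore] -/
theorem complexConj_sqrtNegEleven [IsCMField K] (hζ : IsPrimitiveRoot ζ 44) :
    IsCMField.complexConj K (1 + 2 * (ζ ^ 4 + ζ ^ 12 + ζ ^ 16 + ζ ^ 20 + ζ ^ 36)) = -(1 + 2 * (ζ ^ 4 + ζ ^ 12 + ζ ^ 16 + ζ ^ 20 + ζ ^ 36)) := by
  simp only [map_add, map_mul, map_pow, map_one, map_ofNat, complexConj_eq_inv hζ]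
  rw [inv_pow_eq_pow hζ (show 4 + 40 = 44 by norm_num), inv_pow_eq_pow hζ (show 12 + 32 = 44 by norm_num), inv_pow_eq_pow hζ (show 16 + 28 = 44 by norm_num), inv_pow_eq_pow hζ (show 20 + 24 = 44 by norm_num), inv_pow_eq_pow hζ (show 36 + 8 = 44 by norm_num)]
  linear_combination (2 + 2 * ζ^2 + 2 * ζ^4 + 2 * ζ^6 + 2 * ζ^8 + 2 * ζ^10 + 2 * ζ^12 + 2 * ζ^14 + 2 * ζ^16 + 2 * ζ^18 + 2 * ζ^20) * cyc_fortyFour hζ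

omit [NumberField K] in
/-- **`(ζ¹¹)² = −1`**: `s = √−1 = ζ¹¹ = i` generates `K_d = ℚ(√−1) ⊂ ℚ(ζ_44)`. [folklore] -/
theorem sq_sqrtNegOne (hζ : IsPrimitiveRoot ζ 44) : (ζ ^ 11) ^ 2 = -1 := by
  linear_combination (1 + ζ^2) * cyc_fortyFour hζ

/-- **`s = √−1 = ζ¹¹ = i` is skew** (`s^ρ = −s`). [folklore] -/
theorem complexConj_sqrtNegOne [IsCMField K] (hζ : IsPrimitiveRoot ζ 44) :
    IsCMField.complexConj K (ζ ^ 11) = -(ζ ^ 11) := by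
  simp only [map_pow, complexConj_eq_inv hζ]
  rw [inv_pow_eq_pow hζ (show 11 + 33 = 44 by norm_num)]
  linear_combination (ζ^11 + ζ^13) * cyc_fortyFour hζ

/-! ### §2 `θ^10` on the frame and the trace recurrence -/

/-- **`θ^10` on the frame**: the minimal polynomial of `θ = ζ + ζ⁻¹` over `ℚ` (`Φ_44(x) = x^10ψ(x + x⁻¹)`), i.e.
`θ^10 = 11 - 55 * θ ^ 2 + 77 * θ ^ 4 - 44 * θ ^ 6 + 11 * θ ^ 8`. research route conditional on HC_CM; not a corollary; Q11.4-sentence-2 already refuted in dim ≥ 3. [folklore] -/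
theorem theta_pow_ten (hζ : IsPrimitiveRoot ζ 44) :
    (ζ + ζ⁻¹) ^ 10 = 11 - 55 * (ζ + ζ⁻¹) ^ 2 + 77 * (ζ + ζ⁻¹) ^ 4 - 44 * (ζ + ζ⁻¹) ^ 6 + 11 * (ζ + ζ⁻¹) ^ 8 := by
  have hζ0 : ζ ≠ 0 := hζ.ne_zero (by norm_num)
  have hΦ := cyc_fortyFour hζ
  have hθ : (ζ + ζ⁻¹) * ζ = ζ ^ 2 + 1 := by rw [add_mul, inv_mul_cancel₀ hζ0]; ring
  apply mul_right_cancel₀ (pow_ne_zero 10 hζ0)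
  calc (ζ + ζ⁻¹) ^ 10 * ζ ^ 10 = ((ζ + ζ⁻¹) * ζ) ^ 10 := by ring
    _ = (ζ ^ 2 + 1) ^ 10 := by rw [hθ]
    _ = 11 * ζ ^ 10 - 55 * (ζ ^ 2 + 1) ^ 2 * ζ ^ 8 + 77 * (ζ ^ 2 + 1) ^ 4 * ζ ^ 6 - 44 * (ζ ^ 2 + 1) ^ 6 * ζ ^ 4 +
        11 * (ζ ^ 2 + 1) ^ 8 * ζ ^ 2 := by
      linear_combination hΦ
    _ = 11 * ζ ^ 10 - 55 * ((ζ + ζ⁻¹) * ζ) ^ 2 * ζ ^ 8 + 77 * ((ζ + ζ⁻¹) * ζ) ^ 4 * ζ ^ 6 -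
        44 * ((ζ + ζ⁻¹) * ζ) ^ 6 * ζ ^ 4 + 11 * ((ζ + ζ⁻¹) * ζ) ^ 8 * ζ ^ 2 := by
      rw [hθ]
    _ = (11 - 55 * (ζ + ζ⁻¹) ^ 2 + 77 * (ζ + ζ⁻¹) ^ 4 - 44 * (ζ + ζ⁻¹) ^ 6 + 11 * (ζ + ζ⁻¹) ^ 8) * ζ ^ 10 := by
      ring

/-- The trace recurrence at `θ^10`: `Tr(y·θ^10) = Σ eₖ·Tr(y·θ^{0+k})` from `θ^10 = Σ eₖ θ^k`. [folklore] -/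
theorem trace_mul_theta_pow_ten (hζ : IsPrimitiveRoot ζ 44) (y : K) :
    Algebra.trace ℚ K (y * (ζ + ζ⁻¹) ^ 10) =
      11 * Algebra.trace ℚ K (y) + (-55) * Algebra.trace ℚ K (y * (ζ + ζ⁻¹) ^ 2) +
      77 * Algebra.trace ℚ K (y * (ζ + ζ⁻¹) ^ 4) + (-44) * Algebra.trace ℚ K (y * (ζ + ζ⁻¹) ^ 6) +
      11 * Algebra.trace ℚ K (y * (ζ + ζ⁻¹) ^ 8) := by
  have e : y * (ζ + ζ⁻¹) ^ 10 =
      (11 : ℚ) • (y) + (-55 : ℚ) • (y * (ζ + ζ⁻¹) ^ 2) + (77 : ℚ) • (y * (ζ + ζ⁻¹) ^ 4) +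
      (-44 : ℚ) • (y * (ζ + ζ⁻¹) ^ 6) + (11 : ℚ) • (y * (ζ + ζ⁻¹) ^ 8) := by
    conv_lhs => rw [theta_pow_ten hζ]
    simp only [Rat.smul_def]
    push_cast
    ring
  rw [e]
  simp only [map_add, map_smul, smul_eq_mul]

/-- The trace recurrence at `θ^11`: `Tr(y·θ^11) = Σ eₖ·Tr(y·θ^{1+k})` from `θ^10 = Σ eₖ θ^k`. [folklore] -/
theorem trace_mul_theta_pow_eleven (hζ : IsPrimitiveRoot ζ 44) (y : K) :
    Algebra.trace ℚ K (y * (ζ + ζ⁻¹) ^ 11) =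
      11 * Algebra.trace ℚ K (y * (ζ + ζ⁻¹)) + (-55) * Algebra.trace ℚ K (y * (ζ + ζ⁻¹) ^ 3) +
      77 * Algebra.trace ℚ K (y * (ζ + ζ⁻¹) ^ 5) + (-44) * Algebra.trace ℚ K (y * (ζ + ζ⁻¹) ^ 7) +
      11 * Algebra.trace ℚ K (y * (ζ + ζ⁻¹) ^ 9) := by
  have e : y * (ζ + ζ⁻¹) ^ 11 =
      (11 : ℚ) • (y * (ζ + ζ⁻¹)) + (-55 : ℚ) • (y * (ζ + ζ⁻¹) ^ 3) + (77 : ℚ) • (y * (ζ + ζ⁻¹) ^ 5) +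
      (-44 : ℚ) • (y * (ζ + ζ⁻¹) ^ 7) + (11 : ℚ) • (y * (ζ + ζ⁻¹) ^ 9) := by
    conv_lhs => rw [show y * (ζ + ζ⁻¹) ^ 11 = y * (ζ + ζ⁻¹) * (ζ + ζ⁻¹) ^ 10 by ring, theta_pow_ten hζ]
    simp only [Rat.smul_def]
    push_cast
    ring
  rw [e]
  simp only [map_add, map_smul, smul_eq_mul]

/-- The trace recurrence at `θ^12`: `Tr(y·θ^12) = Σ eₖ·Tr(y·θ^{2+k})` from `θ^10 = Σ eₖ θ^k`. [folklore] -/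
theorem trace_mul_theta_pow_twelve (hζ : IsPrimitiveRoot ζ 44) (y : K) :
    Algebra.trace ℚ K (y * (ζ + ζ⁻¹) ^ 12) =
      11 * Algebra.trace ℚ K (y * (ζ + ζ⁻¹) ^ 2) + (-55) * Algebra.trace ℚ K (y * (ζ + ζ⁻¹) ^ 4) +
      77 * Algebra.trace ℚ K (y * (ζ + ζ⁻¹) ^ 6) + (-44) * Algebra.trace ℚ K (y * (ζ + ζ⁻¹) ^ 8) +
      11 * Algebra.trace ℚ K (y * (ζ + ζ⁻¹) ^ 10) := by
  have e : y * (ζ + ζ⁻¹) ^ 12 =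
      (11 : ℚ) • (y * (ζ + ζ⁻¹) ^ 2) + (-55 : ℚ) • (y * (ζ + ζ⁻¹) ^ 4) + (77 : ℚ) • (y * (ζ + ζ⁻¹) ^ 6) +
      (-44 : ℚ) • (y * (ζ + ζ⁻¹) ^ 8) + (11 : ℚ) • (y * (ζ + ζ⁻¹) ^ 10) := by
    conv_lhs => rw [show y * (ζ + ζ⁻¹) ^ 12 = y * (ζ + ζ⁻¹) ^ 2 * (ζ + ζ⁻¹) ^ 10 by ring, theta_pow_ten hζ]
    simp only [Rat.smul_def]
    push_cast
    ring
  rw [e]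
  simp only [map_add, map_smul, smul_eq_mul]

/-- The trace recurrence at `θ^13`: `Tr(y·θ^13) = Σ eₖ·Tr(y·θ^{3+k})` from `θ^10 = Σ eₖ θ^k`. [folklore] -/
theorem trace_mul_theta_pow_thirteen (hζ : IsPrimitiveRoot ζ 44) (y : K) :
    Algebra.trace ℚ K (y * (ζ + ζ⁻¹) ^ 13) =
      11 * Algebra.trace ℚ K (y * (ζ + ζ⁻¹) ^ 3) + (-55) * Algebra.trace ℚ K (y * (ζ + ζ⁻¹) ^ 5) +
      77 * Algebra.trace ℚ K (y * (ζ + ζ⁻¹) ^ 7) + (-44) * Algebra.trace ℚ K (y * (ζ + ζ⁻¹) ^ 9) +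
      11 * Algebra.trace ℚ K (y * (ζ + ζ⁻¹) ^ 11) := by
  have e : y * (ζ + ζ⁻¹) ^ 13 =
      (11 : ℚ) • (y * (ζ + ζ⁻¹) ^ 3) + (-55 : ℚ) • (y * (ζ + ζ⁻¹) ^ 5) + (77 : ℚ) • (y * (ζ + ζ⁻¹) ^ 7) +
      (-44 : ℚ) • (y * (ζ + ζ⁻¹) ^ 9) + (11 : ℚ) • (y * (ζ + ζ⁻¹) ^ 11) := by
    conv_lhs => rw [show y * (ζ + ζ⁻¹) ^ 13 = y * (ζ + ζ⁻¹) ^ 3 * (ζ + ζ⁻¹) ^ 10 by ring, theta_pow_ten hζ]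
    simp only [Rat.smul_def]
    push_cast
    ring
  rw [e]
  simp only [map_add, map_smul, smul_eq_mul]

/-- The trace recurrence at `θ^14`: `Tr(y·θ^14) = Σ eₖ·Tr(y·θ^{4+k})` from `θ^10 = Σ eₖ θ^k`. [folklore] -/
theorem trace_mul_theta_pow_fourteen (hζ : IsPrimitiveRoot ζ 44) (y : K) :
    Algebra.trace ℚ K (y * (ζ + ζ⁻¹) ^ 14) =
      11 * Algebra.trace ℚ K (y * (ζ + ζ⁻¹) ^ 4) + (-55) * Algebra.trace ℚ K (y * (ζ + ζ⁻¹) ^ 6) +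
      77 * Algebra.trace ℚ K (y * (ζ + ζ⁻¹) ^ 8) + (-44) * Algebra.trace ℚ K (y * (ζ + ζ⁻¹) ^ 10) +
      11 * Algebra.trace ℚ K (y * (ζ + ζ⁻¹) ^ 12) := by
  have e : y * (ζ + ζ⁻¹) ^ 14 =
      (11 : ℚ) • (y * (ζ + ζ⁻¹) ^ 4) + (-55 : ℚ) • (y * (ζ + ζ⁻¹) ^ 6) + (77 : ℚ) • (y * (ζ + ζ⁻¹) ^ 8) +
      (-44 : ℚ) • (y * (ζ + ζ⁻¹) ^ 10) + (11 : ℚ) • (y * (ζ + ζ⁻¹) ^ 12) := by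
    conv_lhs => rw [show y * (ζ + ζ⁻¹) ^ 14 = y * (ζ + ζ⁻¹) ^ 4 * (ζ + ζ⁻¹) ^ 10 by ring, theta_pow_ten hζ]
    simp only [Rat.smul_def]
    push_cast
    ring
  rw [e]
  simp only [map_add, map_smul, smul_eq_mul]

/-- The trace recurrence at `θ^15`: `Tr(y·θ^15) = Σ eₖ·Tr(y·θ^{5+k})` from `θ^10 = Σ eₖ θ^k`. [folklore] -/
theorem trace_mul_theta_pow_fifteen (hζ : IsPrimitiveRoot ζ 44) (y : K) :
    Algebra.trace ℚ K (y * (ζ + ζ⁻¹) ^ 15) =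
      11 * Algebra.trace ℚ K (y * (ζ + ζ⁻¹) ^ 5) + (-55) * Algebra.trace ℚ K (y * (ζ + ζ⁻¹) ^ 7) +
      77 * Algebra.trace ℚ K (y * (ζ + ζ⁻¹) ^ 9) + (-44) * Algebra.trace ℚ K (y * (ζ + ζ⁻¹) ^ 11) +
      11 * Algebra.trace ℚ K (y * (ζ + ζ⁻¹) ^ 13) := by
  have e : y * (ζ + ζ⁻¹) ^ 15 =
      (11 : ℚ) • (y * (ζ + ζ⁻¹) ^ 5) + (-55 : ℚ) • (y * (ζ + ζ⁻¹) ^ 7) + (77 : ℚ) • (y * (ζ + ζ⁻¹) ^ 9) +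
      (-44 : ℚ) • (y * (ζ + ζ⁻¹) ^ 11) + (11 : ℚ) • (y * (ζ + ζ⁻¹) ^ 13) := by
    conv_lhs => rw [show y * (ζ + ζ⁻¹) ^ 15 = y * (ζ + ζ⁻¹) ^ 5 * (ζ + ζ⁻¹) ^ 10 by ring, theta_pow_ten hζ]
    simp only [Rat.smul_def]
    push_cast
    ring
  rw [e]
  simp only [map_add, map_smul, smul_eq_mul]

/-- The trace recurrence at `θ^16`: `Tr(y·θ^16) = Σ eₖ·Tr(y·θ^{6+k})` from `θ^10 = Σ eₖ θ^k`. [folklore] -/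
theorem trace_mul_theta_pow_sixteen (hζ : IsPrimitiveRoot ζ 44) (y : K) :
    Algebra.trace ℚ K (y * (ζ + ζ⁻¹) ^ 16) =
      11 * Algebra.trace ℚ K (y * (ζ + ζ⁻¹) ^ 6) + (-55) * Algebra.trace ℚ K (y * (ζ + ζ⁻¹) ^ 8) +
      77 * Algebra.trace ℚ K (y * (ζ + ζ⁻¹) ^ 10) + (-44) * Algebra.trace ℚ K (y * (ζ + ζ⁻¹) ^ 12) +
      11 * Algebra.trace ℚ K (y * (ζ + ζ⁻¹) ^ 14) := by
  have e : y * (ζ + ζ⁻¹) ^ 16 =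
      (11 : ℚ) • (y * (ζ + ζ⁻¹) ^ 6) + (-55 : ℚ) • (y * (ζ + ζ⁻¹) ^ 8) + (77 : ℚ) • (y * (ζ + ζ⁻¹) ^ 10) +
      (-44 : ℚ) • (y * (ζ + ζ⁻¹) ^ 12) + (11 : ℚ) • (y * (ζ + ζ⁻¹) ^ 14) := by
    conv_lhs => rw [show y * (ζ + ζ⁻¹) ^ 16 = y * (ζ + ζ⁻¹) ^ 6 * (ζ + ζ⁻¹) ^ 10 by ring, theta_pow_ten hζ]
    simp only [Rat.smul_def]
    push_cast
    ring
  rw [e]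
  simp only [map_add, map_smul, smul_eq_mul]

/-- The trace recurrence at `θ^17`: `Tr(y·θ^17) = Σ eₖ·Tr(y·θ^{7+k})` from `θ^10 = Σ eₖ θ^k`. [folklore] -/
theorem trace_mul_theta_pow_seventeen (hζ : IsPrimitiveRoot ζ 44) (y : K) :
    Algebra.trace ℚ K (y * (ζ + ζ⁻¹) ^ 17) =
      11 * Algebra.trace ℚ K (y * (ζ + ζ⁻¹) ^ 7) + (-55) * Algebra.trace ℚ K (y * (ζ + ζ⁻¹) ^ 9) +
      77 * Algebra.trace ℚ K (y * (ζ + ζ⁻¹) ^ 11) + (-44) * Algebra.trace ℚ K (y * (ζ + ζ⁻¹) ^ 13) +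
      11 * Algebra.trace ℚ K (y * (ζ + ζ⁻¹) ^ 15) := by
  have e : y * (ζ + ζ⁻¹) ^ 17 =
      (11 : ℚ) • (y * (ζ + ζ⁻¹) ^ 7) + (-55 : ℚ) • (y * (ζ + ζ⁻¹) ^ 9) + (77 : ℚ) • (y * (ζ + ζ⁻¹) ^ 11) +
      (-44 : ℚ) • (y * (ζ + ζ⁻¹) ^ 13) + (11 : ℚ) • (y * (ζ + ζ⁻¹) ^ 15) := by
    conv_lhs => rw [show y * (ζ + ζ⁻¹) ^ 17 = y * (ζ + ζ⁻¹) ^ 7 * (ζ + ζ⁻¹) ^ 10 by ring, theta_pow_ten hζ]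
    simp only [Rat.smul_def]
    push_cast
    ring
  rw [e]
  simp only [map_add, map_smul, smul_eq_mul]

/-- The trace recurrence at `θ^18`: `Tr(y·θ^18) = Σ eₖ·Tr(y·θ^{8+k})` from `θ^10 = Σ eₖ θ^k`. [folklore] -/
theorem trace_mul_theta_pow_eighteen (hζ : IsPrimitiveRoot ζ 44) (y : K) :
    Algebra.trace ℚ K (y * (ζ + ζ⁻¹) ^ 18) =
      11 * Algebra.trace ℚ K (y * (ζ + ζ⁻¹) ^ 8) + (-55) * Algebra.trace ℚ K (y * (ζ + ζ⁻¹) ^ 10) +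
      77 * Algebra.trace ℚ K (y * (ζ + ζ⁻¹) ^ 12) + (-44) * Algebra.trace ℚ K (y * (ζ + ζ⁻¹) ^ 14) +
      11 * Algebra.trace ℚ K (y * (ζ + ζ⁻¹) ^ 16) := by
  have e : y * (ζ + ζ⁻¹) ^ 18 =
      (11 : ℚ) • (y * (ζ + ζ⁻¹) ^ 8) + (-55 : ℚ) • (y * (ζ + ζ⁻¹) ^ 10) + (77 : ℚ) • (y * (ζ + ζ⁻¹) ^ 12) +
      (-44 : ℚ) • (y * (ζ + ζ⁻¹) ^ 14) + (11 : ℚ) • (y * (ζ + ζ⁻¹) ^ 16) := by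
    conv_lhs => rw [show y * (ζ + ζ⁻¹) ^ 18 = y * (ζ + ζ⁻¹) ^ 8 * (ζ + ζ⁻¹) ^ 10 by ring, theta_pow_ten hζ]
    simp only [Rat.smul_def]
    push_cast
    ring
  rw [e]
  simp only [map_add, map_smul, smul_eq_mul]

end Summit.HodgeConjecture.Ring2WeilCoverage.WeilGramLevel44

end
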